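import Mathlib
import HarnessLib.Audit
import Summits.PneNP.PneNP.Theorems.PstarGConstraint
import Summits.PneNP.PneNP.Theorems.PstarGapPeeling
import Summits.PneNP.PneNP.Theorems.PstarGraphQuadGap
import Summits.PneNP.PneNP.Theorems.PstarProductRank

/-!
# Fibre transport for G-constraints: a set of free variables `U` as the coordinates of `𝔽₂^{|U|+1}` (ROUND-24, GAPTWO-PLAN S3 with a core, I)

FRONTIER range-avoidance ladder, rung F-N3, ROUND 24 (cell `pnp-ideate`, planner memo `r24/GAPTWO-PLAN.md` v0 §3/§4; restricted-model
proof complexity — nothing here bears on `P` versus `NP`).  Technical half of `PstarFreeFolded` (the bound on free folded outputs in the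
presence of a core).

For a set `U` of variables: vertices `Fin (|U|+1)` (`vx`: `U` numbered by `equivFin`, one junk vertex `Fin.last`); `ext z x` overwrites
an assignment `z` on `U` by the coordinates of `x : 𝔽₂^{|U|+1}`; every variable is then AFFINE in `x` (`bit_ext`: coordinate functional
`coordU` plus constant `kap`), an output reading no variable of `U` keeps its value (`eval_ext`), and a G-constraint becomes a quadratic
function of `x` (`bit_gval_ext`) whose quadratic part is the product sum over the edges `TU G` of the `U`-FREE outputs of `G` (both AND
variables in `U`; `sum_coordU_mul`), a simple graph (`simple_TU`, injective slots) of maximum degree `Δ` (`edgeMaxDegree_TU`) in which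
distinct free outputs give distinct edges (`edgeU_injOn`, simple overlaps; `card_filter_free_eq`, `edgeU_mem_TU_iff`).  `restr`/`ext_restr`:
an assignment is the point `restr z` of its own fibre.
-/

set_option linter.dupNamespace false -- `Summit.PneNP.PneNP.…`: summit = sub-problem name (D-0017 single-conjunct layout)

open Finset Module Literature.Computability.Complexity
open Summit.PneNP.PneNP.Theorems.PstarSALevel (varSet SimpleOverlap)
open Summit.PneNP.PneNP.Theorems.PstarGapLemma (MaxDegree)
open Summit.PneNP.PneNP.Theorems.PstarGapLinearised (andPair andPair_subset_varSet)
open Summit.PneNP.PneNP.Theorems.PstarGapPeeling (eval_congr)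
open Summit.PneNP.PneNP.Theorems.PstarFibrePolys (bit bit_injective)
open Summit.PneNP.PneNP.Theorems.PstarProductRank (qform)
open Summit.PneNP.PneNP.Theorems.PstarGraphQuadGap (Edge Simple EdgeMaxDegree)
open Summit.PneNP.PneNP.Theorems.PstarGapOneAll (gval)
open Summit.PneNP.PneNP.Theorems.PstarGConstraint (bit_gval andPairs_simple)

namespace Summit.PneNP.PneNP.Theorems.PstarFreeFoldedFibre


variable {n m : ℕ}

/-! ## Transport of a set of variables `U` to `𝔽₂^{|U|+1}` -/

section Transport

variable (U : Finset (Fin n))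

/-- `𝔽₂ → Bool`. -/
def unbit (t : ZMod 2) : Bool := decide (t ≠ 0)

/-- `bit ∘ unbit = id`. -/
theorem bit_unbit (t : ZMod 2) : bit (unbit t) = t := by
  unfold unbit PstarFibrePolys.bit; revert t; decide

/-- `unbit ∘ bit = id`. -/
theorem unbit_bit (b : Bool) : unbit (bit b) = b := by
  cases b <;> decide

/-- Vertex index of a variable: the variables of `U` are numbered by `Fin |U|` (then shifted by `castSucc`); every other variable goes to
the junk vertex `Fin.last`. -/
noncomputable def vx (v : Fin n) : Fin (U.card + 1) :=
  if h : v ∈ U then Fin.castSucc (U.equivFin ⟨v, h⟩) else Fin.last _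

/-- On `U` the index is a shifted `equivFin` value. -/
theorem vx_of_mem {v : Fin n} (hv : v ∈ U) : vx U v = Fin.castSucc (U.equivFin ⟨v, hv⟩) := by
  unfold vx; rw [dif_pos hv]

/-- Variables of `U` avoid the junk vertex. -/
theorem vx_ne_last {v : Fin n} (hv : v ∈ U) : vx U v ≠ Fin.last _ := by
  rw [vx_of_mem U hv]; exact Fin.castSucc_ne_last _

/-- `vx` is injective on `U`. -/
theorem vx_injOn {u v : Fin n} (hu : u ∈ U) (hv : v ∈ U) (h : vx U u = vx U v) : u = v := by
  rw [vx_of_mem U hu, vx_of_mem U hv] at h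
  have h' := U.equivFin.injective (Fin.castSucc_injective _ h)
  exact congrArg Subtype.val h'

/-- Overwrite `z` on `U` by the (un-bitted) coordinates of `x`. -/
noncomputable def ext (z : Fin n → Bool) (x : Fin (U.card + 1) → ZMod 2) : Fin n → Bool :=
  fun v => if v ∈ U then unbit (x (vx U v)) else z v

/-- Off `U`, `ext` is `z`. -/
theorem ext_of_not_mem (z : Fin n → Bool) (x : Fin (U.card + 1) → ZMod 2) {v : Fin n} (hv : v ∉ U) : ext U z x v = z v := by
  unfold ext; rw [if_neg hv]

/-- On `U`, `ext` reads `x`. -/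
theorem bit_ext_of_mem (z : Fin n → Bool) (x : Fin (U.card + 1) → ZMod 2) {v : Fin n} (hv : v ∈ U) :
    bit (ext U z x v) = x (vx U v) := by
  unfold ext; rw [if_pos hv, bit_unbit]

/-- The coordinate functional of a variable: the projection to its vertex if it lies in `U`, else `0`. -/
noncomputable def coordU (v : Fin n) : (Fin (U.card + 1) → ZMod 2) →ₗ[ZMod 2] ZMod 2 :=
  if v ∈ U then LinearMap.proj (vx U v) else 0

/-- The constant part of a variable on the fibre of `z`: `0` on `U`, `bit (z v)` off `U`. -/
noncomputable def kap (z : Fin n → Bool) (v : Fin n) : ZMod 2 := if v ∈ U then 0 else bit (z v)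

/-- `coordU` on `U`. -/
theorem coordU_of_mem {v : Fin n} (hv : v ∈ U) (x : Fin (U.card + 1) → ZMod 2) : coordU U v x = x (vx U v) := by
  unfold coordU; rw [if_pos hv]; rfl

/-- `coordU` off `U`. -/
theorem coordU_of_not_mem {v : Fin n} (hv : v ∉ U) (x : Fin (U.card + 1) → ZMod 2) : coordU U v x = 0 := by
  unfold coordU; rw [if_neg hv]; rfl

/-- **Every variable is affine on the fibre**: `bit (ext z x v) = coordU v x + kap z v`. -/
theorem bit_ext (z : Fin n → Bool) (x : Fin (U.card + 1) → ZMod 2) (v : Fin n) :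
    bit (ext U z x v) = coordU U v x + kap U z v := by
  unfold kap
  by_cases hv : v ∈ U
  · rw [bit_ext_of_mem U z x hv, coordU_of_mem U hv, if_pos hv, add_zero]
  · rw [ext_of_not_mem U z x hv, coordU_of_not_mem U hv, if_neg hv, zero_add]

/-- The `U`-part of an assignment, as a point of `𝔽₂^{|U|+1}` (junk coordinate `0`). -/
noncomputable def restr (z : Fin n → Bool) : Fin (U.card + 1) → ZMod 2 :=
  Fin.lastCases 0 fun i => bit (z (U.equivFin.symm i).1)

/-- `restr` at the vertex of `v ∈ U` is `bit (z v)`. -/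
theorem restr_vx (z : Fin n → Bool) {v : Fin n} (hv : v ∈ U) : restr U z (vx U v) = bit (z v) := by
  unfold restr
  rw [vx_of_mem U hv, Fin.lastCases_castSucc, Equiv.symm_apply_apply]

/-- Overwriting `z` on `U` by its own `U`-part gives back `z`. -/
theorem ext_restr (z : Fin n → Bool) : ext U z (restr U z) = z := by
  funext v
  by_cases hv : v ∈ U
  · apply bit_injective
    rw [bit_ext_of_mem U z _ hv, restr_vx U z hv]
  · exact ext_of_not_mem U z _ hv

/-- An output reading no variable of `U` keeps its value on the fibre. -/
theorem eval_ext (I : LocalMap 4 n m) (z : Fin n → Bool) (x : Fin (U.card + 1) → ZMod 2) {j : Fin m}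
    (hj : ∀ v ∈ U, v ∉ varSet I j) : I.eval (ext U z x) j = I.eval z j :=
  eval_congr I j fun s => ext_of_not_mem U z x fun h => hj _ h (mem_image.2 ⟨s, mem_univ _, rfl⟩)

/-! ### G-constraints on the fibre -/

variable (I : LocalMap 4 n m)

/-- An output is `U`-FREE when both its AND variables lie in `U`. -/
def FreeU (g : Fin m) : Prop := I.vars g 2 ∈ U ∧ I.vars g 3 ∈ U

/-- The edge of an output: its two AND vertices, in increasing order. -/
noncomputable def edgeU (g : Fin m) : Edge (U.card + 1) :=
  (min (vx U (I.vars g 2)) (vx U (I.vars g 3)), max (vx U (I.vars g 2)) (vx U (I.vars g 3)))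

open Classical in
/-- The edge set of the `U`-free outputs of `G` (classical filter). -/
noncomputable def TU (G : Finset (Fin m)) : Finset (Edge (U.card + 1)) := (G.filter (FreeU U I)).image (edgeU U I)

/-- The linear part of `gval I C G` on the fibre of `z`. -/
noncomputable def linG (z : Fin n → Bool) (C : Finset (Fin n)) (G : Finset (Fin m)) :
    (Fin (U.card + 1) → ZMod 2) →ₗ[ZMod 2] ZMod 2 :=
  ∑ v ∈ C, coordU U v + ∑ g ∈ G, (kap U z (I.vars g 3) • coordU U (I.vars g 2) + kap U z (I.vars g 2) • coordU U (I.vars g 3))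

/-- The constant part of `gval I C G` on the fibre of `z`. -/
noncomputable def constG (z : Fin n → Bool) (C : Finset (Fin n)) (G : Finset (Fin m)) : ZMod 2 :=
  ∑ v ∈ C, kap U z v + ∑ g ∈ G, kap U z (I.vars g 2) * kap U z (I.vars g 3)

/-- **`gval` on the fibre**: product part + linear part + constant. -/
theorem bit_gval_ext (z : Fin n → Bool) (C : Finset (Fin n)) (G : Finset (Fin m)) (x : Fin (U.card + 1) → ZMod 2) :
    bit (gval I C G (ext U z x)) =
      ∑ g ∈ G, coordU U (I.vars g 2) x * coordU U (I.vars g 3) x + linG U I z C G x + constG U I z C G := by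
  rw [bit_gval]
  simp only [bit_ext, linG, constG, LinearMap.add_apply, LinearMap.coe_sum, Finset.sum_apply, LinearMap.smul_apply,
    smul_eq_mul]
  have hG : ∑ g ∈ G, (coordU U (I.vars g 2) x + kap U z (I.vars g 2)) * (coordU U (I.vars g 3) x + kap U z (I.vars g 3)) =
      ∑ g ∈ G, coordU U (I.vars g 2) x * coordU U (I.vars g 3) x +
        ∑ g ∈ G, (kap U z (I.vars g 3) * coordU U (I.vars g 2) x + kap U z (I.vars g 2) * coordU U (I.vars g 3) x) +
        ∑ g ∈ G, kap U z (I.vars g 2) * kap U z (I.vars g 3) := by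
    rw [← sum_add_distrib, ← sum_add_distrib]
    exact sum_congr rfl fun g _ => by ring
  rw [sum_add_distrib, hG]
  ring

/-- For an output that is not `U`-free one of the two coordinate functionals vanishes. -/
theorem coordU_mul_of_not_free {g : Fin m} (hg : ¬ FreeU U I g) (x : Fin (U.card + 1) → ZMod 2) :
    coordU U (I.vars g 2) x * coordU U (I.vars g 3) x = 0 := by
  unfold FreeU at hg
  by_cases h2 : I.vars g 2 ∈ U
  · have h3 : I.vars g 3 ∉ U := fun h3 => hg ⟨h2, h3⟩
    rw [coordU_of_not_mem U h3, mul_zero]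
  · rw [coordU_of_not_mem U h2, zero_mul]

/-- For a `U`-free output the product of the coordinate functionals is the product over its edge. -/
theorem coordU_mul_of_free {g : Fin m} (hg : FreeU U I g) (x : Fin (U.card + 1) → ZMod 2) :
    coordU U (I.vars g 2) x * coordU U (I.vars g 3) x = x (edgeU U I g).1 * x (edgeU U I g).2 := by
  rw [coordU_of_mem U hg.1, coordU_of_mem U hg.2]
  unfold edgeU
  rcases le_total (vx U (I.vars g 2)) (vx U (I.vars g 3)) with h | h
  · rw [min_eq_left h, max_eq_right h]
  · rw [min_eq_right h, max_eq_left h, mul_comm]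

variable (hI : I.IsPure xorAndPred) (hS : SimpleOverlap I)

include hI in
/-- The edge of a free output is increasing (injective slots). -/
theorem edgeU_lt {g : Fin m} (hg : FreeU U I g) : (edgeU U I g).1 < (edgeU U I g).2 := by
  have hne : vx U (I.vars g 2) ≠ vx U (I.vars g 3) := fun h =>
    absurd (hI.2 g (vx_injOn U hg.1 hg.2 h)) (by decide)
  unfold edgeU
  rcases lt_or_gt_of_ne hne with h | h
  · rw [min_eq_left h.le, max_eq_right h.le]; exact h
  · rw [min_eq_right h.le, max_eq_left h.le]; exact h

include hI hS in
/-- **Distinct free outputs have distinct edges** (simple overlaps). -/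
theorem edgeU_injOn {g g' : Fin m} (hg : FreeU U I g) (hg' : FreeU U I g') (h : edgeU U I g = edgeU U I g') : g = g' := by
  classical
  by_contra hne
  have hpairs := (andPairs_simple I hI hS {g, g'}).2 g (by simp) g' (by simp) hne
  apply hpairs
  -- the vertex pairs agree, hence the variable pairs agree
  have hsets : ({vx U (I.vars g 2), vx U (I.vars g 3)} : Finset (Fin (U.card + 1))) =
      {vx U (I.vars g' 2), vx U (I.vars g' 3)} := by
    have key : ∀ a b : Fin (U.card + 1), ({a, b} : Finset _) = {min a b, max a b} := by
      intro a b
      rcases le_total a b with h | h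
      · rw [min_eq_left h, max_eq_right h]
      · rw [min_eq_right h, max_eq_left h, pair_comm]
    rw [key (vx U (I.vars g 2)) (vx U (I.vars g 3)), key (vx U (I.vars g' 2)) (vx U (I.vars g' 3))]
    unfold edgeU at h
    rw [Prod.mk.injEq] at h
    rw [h.1, h.2]
  unfold PstarGapLinearised.andPair
  ext v
  simp only [mem_insert, mem_singleton]
  constructor
  · rintro (rfl | rfl)
    · have hm : vx U (I.vars g 2) ∈ ({vx U (I.vars g' 2), vx U (I.vars g' 3)} : Finset _) := by
        rw [← hsets]; simp
      rw [mem_insert, mem_singleton] at hm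
      rcases hm with e | e
      · exact Or.inl (vx_injOn U hg.1 hg'.1 e)
      · exact Or.inr (vx_injOn U hg.1 hg'.2 e)
    · have hm : vx U (I.vars g 3) ∈ ({vx U (I.vars g' 2), vx U (I.vars g' 3)} : Finset _) := by
        rw [← hsets]; simp
      rw [mem_insert, mem_singleton] at hm
      rcases hm with e | e
      · exact Or.inl (vx_injOn U hg.2 hg'.1 e)
      · exact Or.inr (vx_injOn U hg.2 hg'.2 e)
  · rintro (rfl | rfl)
    · have hm : vx U (I.vars g' 2) ∈ ({vx U (I.vars g 2), vx U (I.vars g 3)} : Finset _) := by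
        rw [hsets]; simp
      rw [mem_insert, mem_singleton] at hm
      rcases hm with e | e
      · exact Or.inl (vx_injOn U hg'.1 hg.1 e)
      · exact Or.inr (vx_injOn U hg'.1 hg.2 e)
    · have hm : vx U (I.vars g' 3) ∈ ({vx U (I.vars g 2), vx U (I.vars g 3)} : Finset _) := by
        rw [hsets]; simp
      rw [mem_insert, mem_singleton] at hm
      rcases hm with e | e
      · exact Or.inl (vx_injOn U hg'.2 hg.1 e)
      · exact Or.inr (vx_injOn U hg'.2 hg.2 e)

include hI hS in
/-- **The product part is the product sum of the free edges.** -/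
theorem sum_coordU_mul (G : Finset (Fin m)) (x : Fin (U.card + 1) → ZMod 2) :
    ∑ g ∈ G, coordU U (I.vars g 2) x * coordU U (I.vars g 3) x = qform (TU U I G) Prod.fst Prod.snd x := by
  classical
  unfold PstarProductRank.qform TU
  rw [sum_image fun g hg g' hg' h => edgeU_injOn U I hI hS (mem_filter.1 hg).2 (mem_filter.1 hg').2 h, sum_filter]
  refine sum_congr rfl fun g _ => ?_
  split_ifs with h
  · exact coordU_mul_of_free U I h x
  · exact coordU_mul_of_not_free U I h x

include hI in
/-- The free edge set is a simple graph. -/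
theorem simple_TU (G : Finset (Fin m)) : Simple (TU U I G) := by
  classical
  intro t ht
  unfold TU at ht
  obtain ⟨g, hg, rfl⟩ := mem_image.1 ht
  exact edgeU_lt U I hI (mem_filter.1 hg).2

/-- The free edge set has maximum degree `Δ` when the instance has. -/
theorem edgeMaxDegree_TU {Δ : ℕ} (hD : MaxDegree Δ I) (G : Finset (Fin m)) : EdgeMaxDegree Δ (TU U I G) := by
  classical
  intro w
  -- an edge at `w` comes from a free output reading the variable of `w`
  by_cases hw : ∃ v ∈ U, vx U v = w
  · obtain ⟨v, hvU, rfl⟩ := hw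
    have hsub : (TU U I G).filter (fun e => e.1 = vx U v ∨ e.2 = vx U v) ⊆
        ((univ : Finset (Fin m)).filter fun j => v ∈ varSet I j).image (edgeU U I) := by
      intro t ht
      rw [mem_filter] at ht
      obtain ⟨ht, htv⟩ := ht
      unfold TU at ht
      obtain ⟨g, hg, rfl⟩ := mem_image.1 ht
      have hfree := (mem_filter.1 hg).2
      refine mem_image.2 ⟨g, mem_filter.2 ⟨mem_univ _, ?_⟩, rfl⟩
      -- one of the AND vertices of `g` is `vx v`, so `g` reads `v`
      have hor : vx U (I.vars g 2) = vx U v ∨ vx U (I.vars g 3) = vx U v := by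
        unfold edgeU at htv
        rcases le_total (vx U (I.vars g 2)) (vx U (I.vars g 3)) with h | h
        · rw [min_eq_left h, max_eq_right h] at htv; exact htv
        · rw [min_eq_right h, max_eq_left h] at htv; exact htv.symm
      rcases hor with e | e
      · rw [← vx_injOn U hfree.1 hvU e]; exact andPair_subset_varSet I g (by simp [PstarGapLinearised.andPair])
      · rw [← vx_injOn U hfree.2 hvU e]; exact andPair_subset_varSet I g (by simp [PstarGapLinearised.andPair])
    exact (card_le_card hsub).trans (card_image_le.trans (hD v))
  · -- no edge at a vertex outside the image of `U` (free outputs have both vertices in that image)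
    push Not at hw
    have h0 : (TU U I G).filter (fun e => e.1 = w ∨ e.2 = w) = ∅ := by
      refine filter_eq_empty_iff.2 fun t ht => ?_
      unfold TU at ht
      obtain ⟨g, hg, rfl⟩ := mem_image.1 ht
      have hfree := (mem_filter.1 hg).2
      unfold edgeU
      rcases le_total (vx U (I.vars g 2)) (vx U (I.vars g 3)) with h | h
      · rw [min_eq_left h, max_eq_right h]; exact not_or.2 ⟨hw _ hfree.1, hw _ hfree.2⟩
      · rw [min_eq_right h, max_eq_left h]; exact not_or.2 ⟨hw _ hfree.2, hw _ hfree.1⟩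
    rw [h0, card_empty]; exact Nat.zero_le _

include hI hS in
/-- Membership of a free edge in `TU G` is membership of its output in `G`. -/
theorem edgeU_mem_TU_iff {G : Finset (Fin m)} {g : Fin m} (hg : FreeU U I g) : edgeU U I g ∈ TU U I G ↔ g ∈ G := by
  classical
  unfold TU
  rw [mem_image]
  constructor
  · rintro ⟨g', hg', he⟩
    rw [← edgeU_injOn U I hI hS (mem_filter.1 hg').2 hg he]
    exact (mem_filter.1 hg').1
  · exact fun h => ⟨g, mem_filter.2 ⟨h, hg⟩, rfl⟩

include hI hS in
open Classical in
/-- The free outputs of `G` are counted by their edges. -/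
theorem card_filter_free_eq (G : Finset (Fin m)) : (G.filter (FreeU U I)).card = (TU U I G).card := by
  classical
  unfold TU
  rw [card_image_of_injOn fun g hg g' hg' h =>
    edgeU_injOn U I hI hS (mem_filter.1 (mem_coe.1 hg)).2 (mem_filter.1 (mem_coe.1 hg')).2 h]

end Transport

end Summit.PneNP.PneNP.Theorems.PstarFreeFoldedFibre
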